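import Literature.Computability.Cryptography.IndistinguishableFarEnsemblesFunction
import Literature.Computability.Cryptography.AffineHashThreewise
import HarnessLib

/-!
# Constructible, indistinguishable, far-apart ensembles give one-way functions, IV: one attempt of the distinguisher

Fourth file of the discharge of `Goldreich2001_owfExist_of_indistinguishable_farApart` (Goldreich 2001, §3.8
Exercise 11 with Ch. 2 Exercise 17). Fix the data `P` (two samplers), an inverter `A` of the hashed candidate
`F = g f̃` and an input length `m` of `F` (level `N = lvl m`, `f̃`-input length `L = nLen N`, parameter
`n = nPar L`, guess width `t`). The distinguisher of the next file, given a sample `z` (of `X n` or `Y n`), works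
with the slice image `y = bits ℓ₀ ‖ bits ℓ₁ ‖ enc z` and makes ATTEMPTS: at hash level `i` it draws a key `ρ`, a
target `α` and coins `r_A`, queries `A` on `⟨1^m, y ‖ maskTo_N^i(α) ‖ ι_i ‖ ρ⟩` and, if the answer `w'` is a
genuine preimage (`F w' =` the query body), reads off the selector bit `w'[2t]` of `w'`. This is the step "output
an `F`-preimage of `(y, i, r, h)` where `r` and `h` are uniformly chosen" of Goldreich's guideline to Ch. 2
Exercise 17, and the present file is its analysis at one level, entirely by finite counting:

* objects (`FarApartOWF.Ctx`): the fibre `fib y ⊆ {0,1}^{L−2t}` of rest-strings `u` with `f̃(sp ‖ u) = y`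
  (`sp` the slice prefix) and its halves `fibB y σ` (selector bit `σ`); the single-attempt probabilities
  `s y i σ` (valid answer with bit `σ`) and the per-element quantities `ret u i` (the answer IS `sp ‖ u ‖ ι ‖ ρ` on
  the query with target `h_ρ(sp ‖ u)`), `nat u i` (natural success of `A` on the input `sp ‖ u ‖ ι_i ‖ ρ`),
  `coll y u i` (some other fibre element shares `u`'s hash prefix);
* `valid_iff` — a valid answer is `x' ‖ ι_i ‖ ρ` with `f̃ x' = y` and `h_ρ(x')` of the right prefix; such `x'`
  lie in the slice (`take_eq_slicePref_of_ftil_eq`);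
* **`s_eq`** — the identity `s y i σ = 2^{-(i + eLen N)} Σ_{u ∈ fibB y σ} ret u i` (for fixed key and coins the
  valid targets are the disjoint union of the prefix classes of the returned fibre elements, each of size
  `2^{hLen N − (i + eLen N)}`; cf. HILL 1999, Lemma 5.1.2 (1), the same count in `HILLHashedFunction.sum_recovered_le`);
* **`nat_sub_coll_le_ret`** — `ret u ≥ nat u − coll u` (if `A` inverts and `u` is alone in its prefix class, the
  answer is `u`); `coll_le` — `coll ≤ (|fib y| − 1) 2^{-(i+eLen N)}` by pairwise independence of the affine hash
  (`card_filter_prefixZ_agree_mul`, `card_filter_hashV_pair`);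
* the consequences used by the scan analysis: `s_le`, `p_ge`, **`abs_bias_le`**:
  `|s y i 1 − p y i · π₁| ≤ 2^{-(i+eLen N)} Fail(y,i) + x²`, `p y i ≥ x − 2^{-(i+eLen N)} Fail(y,i) − x²` with
  `x = |fib y| / 2^{i + eLen N}`, `π₁ = |fibB y 1| / |fib y|`, `Fail(y,i) = Σ_{u ∈ fib y} (1 − nat u i)`.

## References

* O. Goldreich, *Foundations of Cryptography I*, CUP 2001, Ch. 2 Exercise 17 (guideline), §3.8 Exercise 11.
* R. Impagliazzo, M. Luby, FOCS 1989, §4 (distributionally one-way functions).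
* J. Håstad, R. Impagliazzo, L. Levin, M. Luby, SIAM J. Comput. 28 (1999), Lemma 5.1.2 (1) (the prefix count).
-/

namespace Literature.Computability.Cryptography

open Finset Polynomial _root_.Computability Complexity AffineStr HILL

noncomputable section

namespace FarApartOWF

/-- **The context of one input length**: the data `P`, an inverter `A` and an input length `m` of `F`. [folklore] -/
structure Ctx where
  /-- the two samplers and the polynomials -/
  P : Params
  /-- the inverter -/
  A : RandAlg (List Bool) (List Bool)
  /-- the attacked input length of `F` -/
  m : ℕ

namespace Ctx

variable (C : Ctx)

/-! ### Derived parameters -/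

/-- The level `N = lvl m`. [folklore] -/
def N : ℕ := lvl C.m
/-- The `f̃`-input length `L = nLen N`. [folklore] -/
def L : ℕ := nLen C.N
/-- The ensemble index `n = nPar L`. [folklore] -/
def n : ℕ := C.P.nPar C.L
/-- The guess width `t`. [folklore] -/
def t : ℕ := C.P.tLen C.n
/-- The rest length `L − 2t`. [folklore] -/
def rl : ℕ := C.L - 2 * C.t
/-- The key length `m − N`. [folklore] -/
def klen : ℕ := C.m - C.N
/-- The index-block length `N − L`. [folklore] -/
def il : ℕ := C.N - C.L
/-- The length of every query `⟨1^m, F v⟩`, `|v| = m`. [folklore] -/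
def qlen : ℕ := 3 * C.m + 2 + hLen C.N
/-- `A`'s coin count on the queries. [folklore] -/
def κ : ℕ := C.A.coinLen C.qlen
/-- The prefix length of level `i`: `i + eLen N`. [folklore] -/
def pfx (i : ℕ) : ℕ := i + eLen C.N
/-- The slice prefix `sp = bits ℓ₀(n) ‖ bits ℓ₁(n)`. [folklore] -/
def sp : List Bool := C.P.slicePref C.n
/-- The index block of level `i`. [folklore] -/
def ιb (i : ℕ) : List Bool := Params.bitsT C.il i
/-- `sp ‖ u`. [folklore] -/
def xu (u : List Bool) : List Bool := C.sp ++ u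
/-- The hash `h_ρ(x)` (`nLen N`-bit inputs, `hLen N`-bit values, key `ρ`). [folklore] -/
def hρ (ρ x : List Bool) : List Bool := hashStr C.L (hLen C.N) ρ x
/-- **The query** `⟨1^m, y ‖ maskTo_N^i(α) ‖ ι_i ‖ ρ⟩`. [cite: Goldreich2001, Ch. 2 Exercise 17 (guideline: "invert F on (y, i, r, h)")] -/
def qry (y : List Bool) (i : ℕ) (α ρ : List Bool) : List Bool := boolPair (unaryEncodeNat C.m) (body C.N y (C.ιb i) α ρ)
/-- The selector bit read off an answer: `w'[2t]`. [folklore] -/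
def outBit (w : List Bool) : Bool := w.getD (2 * C.t) false

/-- **The well-formedness hypotheses of the context**: `m` is a genuine length (`≥ 6`, level `≥ 1`), the length `L`
is served by `f̃`, and the coin counts at `n` are within the bound `pc`. [folklore] -/
structure WF : Prop where
  /-- `6 ≤ m` -/
  six_le : 6 ≤ C.m
  /-- `1 ≤ N` -/
  one_le_N : 1 ≤ C.N
  /-- the length `L` is served -/
  served : C.P.Q C.n ≤ C.L
  /-- coin bounds at `n` -/
  coin : ∀ σ, C.P.ell σ C.n ≤ C.P.pc.eval C.n

variable {C}

/-! ### Length bookkeeping -/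

/-- `sl N ≤ m`. [folklore] -/
theorem WF.sl_le (h : C.WF) : sl C.N ≤ C.m := sl_lvl_le h.six_le

/-- `N ≤ m`. [folklore] -/
theorem WF.N_le (_h : C.WF) : C.N ≤ C.m := lvl_le _

/-- `N + klen = m`. [folklore] -/
theorem WF.klen_eq (h : C.WF) : C.N + C.klen = C.m := by have := h.N_le; unfold klen; omega

/-- The key is at least `rlen N` long. [folklore] -/
theorem WF.rlen_le_klen (h : C.WF) : rlen C.N ≤ C.klen := by have := h.sl_le; unfold klen sl at *; omega

/-- `il = bLen N`. [folklore] -/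
theorem WF.il_eq (h : C.WF) : C.il = bLen C.N := by unfold il L; exact ibLen_eq h.one_le_N

/-- `L + il = N`. [folklore] -/
theorem WF.L_add_il (_h : C.WF) : C.L + C.il = C.N := by unfold il L; exact nLen_add_ibLen _

/-- `2t + 2 ≤ L`. [folklore] -/
theorem WF.two_t_le (h : C.WF) : 2 * C.t + 2 ≤ C.L := by have := C.P.fields_le h.served; unfold t n at *; omega

/-- `2t + rl = L`. [folklore] -/
theorem WF.rl_eq (h : C.WF) : 2 * C.t + C.rl = C.L := by have := h.two_t_le; unfold rl; omega

/-- `|sp| = 2t`. [folklore] -/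
theorem WF.length_sp (h : C.WF) : C.sp.length = 2 * C.t := C.P.length_slicePref h.coin

/-- `|sp ‖ u| = L` for a rest string `u`. [folklore] -/
theorem WF.length_xu (h : C.WF) {u : List Bool} (hu : u.length = C.rl) : (C.xu u).length = C.L := by
  rw [xu, List.length_append, h.length_sp, hu, h.rl_eq]

/-- `L < 2^{il}` (every scanned level has an index block). [folklore] -/
theorem WF.L_lt_two_pow_il (h : C.WF) : C.L < 2 ^ C.il := by
  rw [h.il_eq]; exact (nLen_le _).trans_lt (lt_two_pow_bLen _)

/-- `|ι_i| = il` for `i ≤ L`. [folklore] -/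
theorem WF.length_ιb (h : C.WF) {i : ℕ} (hi : i ≤ C.L) : (C.ιb i).length = C.il :=
  Params.length_bitsT (lt_of_le_of_lt hi h.L_lt_two_pow_il)

/-- The index read off `ι_i` is `i`. [folklore] -/
theorem WF.icap_ιb (h : C.WF) {i : ℕ} (hi : i ≤ C.L) : icap C.N (C.ιb i) = i := by
  rw [icap_eq (by rw [h.length_ιb hi, h.il_eq]), ιb, Params.bitsToNat_bitsT]

/-- The key is long enough for the affine family: `hLen N (L + 1) ≤ klen`. [folklore] -/
theorem WF.hLen_mul_le_klen (h : C.WF) : hLen C.N * (C.L + 1) ≤ C.klen := (hLen_mul_le_rlen _).trans h.rlen_le_klen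

/-- `pfx i ≤ hLen N` for `i ≤ L`. [folklore] -/
theorem WF.pfx_le (_h : C.WF) {i : ℕ} (hi : i ≤ C.L) : C.pfx i ≤ hLen C.N := by unfold pfx hLen L at *; omega

/-- `|h_ρ(x)| = hLen N`. [folklore] -/
theorem length_hρ (ρ x : List Bool) : (C.hρ ρ x).length = hLen C.N := length_hashStr ..

/-- The length of a query body. [folklore] -/
theorem WF.length_body (h : C.WF) {y α ρ : List Bool} {i : ℕ} (hy : y.length = C.L) (hα : α.length = hLen C.N)
    (hρ : ρ.length = C.klen) (hi : i ≤ C.L) : (body C.N y (C.ιb i) α ρ).length = C.m + hLen C.N := by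
  rw [HILL.length_body _ _ _ hα, hy, h.length_ιb hi, hρ]
  have := h.L_add_il; have := h.klen_eq; omega

/-- **Every query has length `qlen`.** [folklore] -/
theorem WF.length_qry (h : C.WF) {y α ρ : List Bool} {i : ℕ} (hy : y.length = C.L) (hα : α.length = hLen C.N)
    (hρ : ρ.length = C.klen) (hi : i ≤ C.L) : (C.qry y i α ρ).length = C.qlen := by
  rw [qry, length_boolPair, h.length_body hy hα hρ hi, qlen]
  simp [Complexity.unaryEncodeNat_eq_replicate]; ring

/-- The inverter's genuine input `⟨1^m, F v⟩`, `|v| = m`, has length `qlen`. [folklore] -/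
theorem length_pair_F {v : List Bool} (hv : v.length = C.m) : (boolPair (unaryEncodeNat C.m) (C.P.F v)).length = C.qlen := by
  rw [length_boolPair, Params.length_F, hv, qlen, N]
  simp [Complexity.unaryEncodeNat_eq_replicate]; ring

/-! ### `F` on the natural inputs of the level -/

/-- **`F` on `x ‖ ι_i ‖ ρ`** (`|x| = L`, `|ρ| = klen`, `i ≤ L`): `body N (f̃ x) ι_i (h_ρ x) ρ`. [folklore] -/
theorem WF.F_nat (h : C.WF) {x ρ : List Bool} (hx : x.length = C.L) (hρ : ρ.length = C.klen) {i : ℕ} (hi : i ≤ C.L) :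
    C.P.F (x ++ C.ιb i ++ ρ) = body C.N (C.P.ftil x) (C.ιb i) (C.hρ ρ x) ρ := by
  have hι := h.length_ιb hi
  have hw : (x ++ C.ιb i).length = C.N := by rw [List.length_append, hx, hι, h.L_add_il]
  have hv : (x ++ C.ιb i ++ ρ).length = C.m := by rw [List.length_append, hw, hρ, h.klen_eq]
  have hl : lvl (x ++ C.ιb i ++ ρ).length = C.N := by rw [hv]; rfl
  rw [Params.F, g_eq_of_lvl hl, List.take_left' hw, List.drop_left' hw, xOf_append hx (by rw [hι]; rfl),
    iBits_append hx (by rw [hι]; rfl)]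
  rfl

/-- `f̃ = core n` at length `L`. [folklore] -/
theorem WF.ftil_eq_core (h : C.WF) {x : List Bool} (hx : x.length = C.L) : C.P.ftil x = C.P.core C.n x := by
  have hs : C.P.Q (C.P.nPar x.length) ≤ x.length := by rw [hx]; exact h.served
  unfold Params.ftil
  rw [if_pos hs, hx]
  rfl

/-- `f̃ x` has length `L` for `|x| = L`. [folklore] -/
theorem length_ftil {x : List Bool} (hx : x.length = C.L) : (C.P.ftil x).length = C.L := by
  rw [C.P.isLengthPreserving_ftil, hx]

/-- **`f̃` on the slice**: `f̃(sp ‖ u) = sp ‖ enc(zOfRest u)`. [folklore] -/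
theorem WF.ftil_xu (h : C.WF) {u : List Bool} (hu : u.length = C.rl) :
    C.P.ftil (C.xu u) = C.sp ++ C.P.enc C.n C.L (C.P.zOfRest C.n u) := by
  have hl : (C.P.slicePref C.n ++ u).length = C.L := h.length_xu hu
  rw [h.ftil_eq_core (h.length_xu hu)]
  unfold xu sp
  rw [Params.core_slice _ h.coin, hl]

/-- **Preimages of slice images lie in the slice**: if `|x'| = L` and `f̃ x' = f̃ (sp ‖ u)` then `x' = sp ‖ (x' ⇂ 2t)`.
[folklore] -/
theorem WF.eq_xu_of_ftil_eq (h : C.WF) {u x' : List Bool} (hu : u.length = C.rl) (hx' : x'.length = C.L)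
    (he : C.P.ftil x' = C.P.ftil (C.xu u)) : x' = C.xu (x'.drop (2 * C.t)) := by
  have h2t := h.two_t_le
  rw [h.ftil_eq_core hx', h.ftil_eq_core (h.length_xu hu)] at he
  obtain ⟨ha, hb, -⟩ := (C.P.core_eq_core_iff (by rw [h.length_xu hu]; unfold t at h2t; omega)
    (by rw [hx', h.length_xu hu])).1 he
  have hsp : C.P.aOf C.n (C.xu u) ++ C.P.bOf C.n (C.xu u) = C.sp := by
    have hl0 := Params.length_bitsT ((h.coin false).trans_lt (C.P.lt_two_pow_tLen C.n))
    have hl1 := Params.length_bitsT ((h.coin true).trans_lt (C.P.lt_two_pow_tLen C.n))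
    rw [xu, sp, Params.slicePref, Params.aOf, Params.bOf, List.append_assoc, List.take_left' hl0, List.drop_left' hl0,
      List.take_left' hl1]
  have hx2 : C.P.aOf C.n x' ++ C.P.bOf C.n x' = x'.take (2 * C.t) := by
    rw [Params.aOf, Params.bOf, two_mul, List.take_add]; rfl
  calc x' = x'.take (2 * C.t) ++ x'.drop (2 * C.t) := (List.take_append_drop _ _).symm
    _ = C.xu (x'.drop (2 * C.t)) := by rw [← hx2, ha, hb, hsp, xu]

/-- `0 < rl` (the rest carries at least the selector bit). [folklore] -/
theorem WF.rl_pos (h : C.WF) : 0 < C.rl := by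
  have := C.P.fields_le h.served; unfold rl t n at *; omega

/-- The selector bit of `sp ‖ u` is the first bit of `u` (`u` a genuine rest string). [folklore] -/
theorem WF.outBit_xu (h : C.WF) {u : List Bool} (hu : u.length = C.rl) (w : List Bool) : C.outBit (C.xu u ++ w) = Params.sgR u := by
  have hpos := h.rl_pos
  rw [outBit, Params.sgR, xu, List.append_assoc, List.getD_eq_getElem?_getD, List.getD_eq_getElem?_getD,
    List.getElem?_append_right (by rw [h.length_sp]), h.length_sp, Nat.sub_self]
  cases u with
  | nil => simp at hu; omega
  | cons b u => simp

/-! ### Validity of an answer -/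

/-- **Reading a valid answer.** For a query body with `|y| = L`, `|α| = hLen N`, `|ρ| = klen`, `i ≤ L`:
`F w' = body N y ι_i α ρ` iff `w' = x' ‖ ι_i ‖ ρ` for an `x'` of length `L` with `f̃ x' = y` whose hash under `ρ`
has the same `(i + eLen N)`-prefix as `α`. [folklore] -/
theorem WF.F_eq_body_iff (h : C.WF) {y α ρ w' : List Bool} {i : ℕ} (hy : y.length = C.L) (hα : α.length = hLen C.N)
    (hρ : ρ.length = C.klen) (hi : i ≤ C.L) :
    C.P.F w' = body C.N y (C.ιb i) α ρ ↔
      ∃ x' : List Bool, x'.length = C.L ∧ w' = x' ++ C.ιb i ++ ρ ∧ C.P.ftil x' = y ∧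
        (C.hρ ρ x').take (C.pfx i) = α.take (C.pfx i) := by
  have hι := h.length_ιb hi
  have hicap := h.icap_ιb hi
  constructor
  · intro he
    -- the answer has length `m`
    have hlen : w'.length = C.m := by
      have h1 := congrArg List.length he
      rw [Params.length_F, h.length_body hy hα hρ hi] at h1
      exact strictMono_outLen.injective (h1.trans (by rfl : C.m + hLen C.N = C.m + hLen (lvl C.m)))
    have hl : lvl w'.length = C.N := by rw [hlen]; rfl
    have hNle : C.N ≤ w'.length := by rw [hlen]; exact h.N_le
    have hw : (w'.take C.N).length = C.N := by rw [List.length_take, min_eq_left hNle]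
    rw [Params.F, g_eq_of_lvl hl, HILL.body, HILL.body] at he
    have hxlen : (xOf (w'.take C.N)).length = C.L := by rw [length_xOf, hw]; rfl
    have hf : (C.P.ftil (xOf (w'.take C.N))).length = y.length := by rw [length_ftil hxlen, hy]
    have hm : (maskTo C.N (icap C.N (iBits (w'.take C.N))) (hashStr (nLen C.N) (hLen C.N) (w'.drop C.N) (xOf (w'.take C.N)))).length =
        (maskTo C.N (icap C.N (C.ιb i)) α).length := by rw [length_maskTo (length_hashStr ..), length_maskTo hα]
    have hib : (iBits (w'.take C.N)).length = (C.ιb i).length := by rw [length_iBits, hw, hι]; rfl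
    rw [List.append_assoc, List.append_assoc, List.append_assoc, List.append_assoc] at he
    obtain ⟨h1, he⟩ := List.append_inj he hf
    obtain ⟨h2, he⟩ := List.append_inj he hm
    obtain ⟨h3, h4⟩ := List.append_inj he hib
    refine ⟨xOf (w'.take C.N), hxlen, ?_, h1, ?_⟩
    · calc w' = w'.take C.N ++ w'.drop C.N := (List.take_append_drop _ _).symm
        _ = xOf (w'.take C.N) ++ iBits (w'.take C.N) ++ w'.drop C.N := by rw [xOf_append_iBits]
        _ = xOf (w'.take C.N) ++ C.ιb i ++ ρ := by rw [h3, h4]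
    · rw [h3, hicap, h4] at h2
      exact take_eq_of_maskTo_eq (length_hashStr ..) hα h2
  · rintro ⟨x', hx', rfl, hfx, hpre⟩
    rw [h.F_nat hx' hρ hi, hfx, HILL.body, HILL.body, hicap, maskTo_eq_of_take_eq' le_rfl hpre]

/-- Queries depend on the target only through its `(i + eLen N)`-prefix. [folklore] -/
theorem WF.qry_eq_of_take_eq (h : C.WF) {y α α' ρ : List Bool} {i : ℕ} (hi : i ≤ C.L)
    (he : α.take (C.pfx i) = α'.take (C.pfx i)) : C.qry y i α ρ = C.qry y i α' ρ := by
  rw [qry, qry, HILL.body, HILL.body, h.icap_ιb hi, maskTo_eq_of_take_eq' le_rfl he]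

/-- **The natural query is the query with target `h_ρ(x)`**: `⟨1^m, F(x ‖ ι_i ‖ ρ)⟩ = qry (f̃ x) i (h_ρ x) ρ`. [folklore] -/
theorem WF.pair_F_nat (h : C.WF) {x ρ : List Bool} (hx : x.length = C.L) (hρ : ρ.length = C.klen) {i : ℕ} (hi : i ≤ C.L) :
    boolPair (unaryEncodeNat C.m) (C.P.F (x ++ C.ιb i ++ ρ)) = C.qry (C.P.ftil x) i (C.hρ ρ x) ρ := by
  rw [h.F_nat hx hρ hi, qry]

/-! ### The fibres and the single-attempt quantities -/

open scoped Classical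

/-- **The fibre of a slice image**: the rest strings `u ∈ {0,1}^{L−2t}` with `f̃(sp ‖ u) = y`. [folklore] -/
def fib (y : List Bool) : Finset (List.Vector Bool C.rl) := univ.filter fun u => C.P.ftil (C.xu u.toList) = y

/-- The half of the fibre with selector bit `σ`. [folklore] -/
def fibB (y : List Bool) (σ : Bool) : Finset (List.Vector Bool C.rl) := (C.fib y).filter fun u => Params.sgR u.toList = σ

/-- The answer of `A` on the query `(y, i, α, ρ)` with coins `r_A`. [folklore] -/
def ans (y : List Bool) (i : ℕ) (α ρ rA : List Bool) : List Bool := C.A.run (C.qry y i α ρ) rA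

/-- **Validity**: the answer is a genuine preimage of the query body. [folklore] -/
def Valid (y : List Bool) (i : ℕ) (α ρ rA : List Bool) : Prop := C.P.F (C.ans y i α ρ rA) = body C.N y (C.ιb i) α ρ

/-- The indicator of "valid answer with selector bit `σ`". [folklore] -/
def sInd (y : List Bool) (i : ℕ) (σ : Bool) (α ρ rA : List Bool) : ℝ :=
  if C.Valid y i α ρ rA ∧ C.outBit (C.ans y i α ρ rA) = σ then 1 else 0

/-- **`s y i σ`**: the probability (key, target, coins uniform) that one attempt at level `i` yields a valid answer
with selector bit `σ`. [folklore] -/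
def s (y : List Bool) (i : ℕ) (σ : Bool) : ℝ :=
  uniformAvg C.klen fun ρ => uniformAvg (hLen C.N) fun α => uniformAvg C.κ fun rA => C.sInd y i σ α ρ rA

/-- **`p y i`**: the success probability of one attempt at level `i`. [folklore] -/
def p (y : List Bool) (i : ℕ) : ℝ := C.s y i false + C.s y i true

/-- The natural query of the rest string `u` at level `i` with key `ρ`: image `f̃(sp ‖ u)`, target `h_ρ(sp ‖ u)` —
this is `⟨1^m, F(sp ‖ u ‖ ι_i ‖ ρ)⟩` (`natQ_eq`). [folklore] -/
def natQ (u : List Bool) (i : ℕ) (ρ : List Bool) : List Bool := C.qry (C.P.ftil (C.xu u)) i (C.hρ ρ (C.xu u)) ρ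

/-- `A` returns exactly `sp ‖ u ‖ ι_i ‖ ρ` on the natural query of `u`. [folklore] -/
def Returns (u : List Bool) (i : ℕ) (ρ rA : List Bool) : Prop := C.A.run (C.natQ u i ρ) rA = C.xu u ++ C.ιb i ++ ρ

/-- `ret u i = Pr_{ρ, r_A}[Returns]`. [folklore] -/
def ret (u : List Bool) (i : ℕ) : ℝ := uniformAvg C.klen fun ρ => uniformAvg C.κ fun rA => if C.Returns u i ρ rA then 1 else 0

/-- `A` inverts `F` on the natural input `sp ‖ u ‖ ι_i ‖ ρ`. [folklore] -/
def Inverts (u : List Bool) (i : ℕ) (ρ rA : List Bool) : Prop := C.P.F (C.A.run (C.natQ u i ρ) rA) = C.P.F (C.xu u ++ C.ιb i ++ ρ)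

/-- **`nat u i`**: the natural success probability of `A` on `sp ‖ u ‖ ι_i ‖ ρ` (`ρ`, `r_A` uniform). [folklore] -/
def nat (u : List Bool) (i : ℕ) : ℝ := uniformAvg C.klen fun ρ => uniformAvg C.κ fun rA => if C.Inverts u i ρ rA then 1 else 0

/-- Some OTHER element of the fibre of `y` shares the level-`i` hash prefix of `u` under the key `ρ`. [folklore] -/
def Coll (y u : List Bool) (i : ℕ) (ρ : List Bool) : Prop :=
  ∃ u' ∈ C.fib y, u'.toList ≠ u ∧ (C.hρ ρ (C.xu u'.toList)).take (C.pfx i) = (C.hρ ρ (C.xu u)).take (C.pfx i)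

/-- `coll y u i = Pr_ρ[Coll]`. [folklore] -/
def coll (y u : List Bool) (i : ℕ) : ℝ := uniformAvg C.klen fun ρ => if C.Coll y u i ρ then 1 else 0

/-- **The unnormalised natural failure** `Fail(y, i) = Σ_{u ∈ fib y} (1 − nat u i)`. [folklore] -/
def Fail (y : List Bool) (i : ℕ) : ℝ := ∑ u ∈ C.fib y, (1 - C.nat u.toList i)

/-- The natural failure of one half, `FailB(y, σ, i) = Σ_{u ∈ fibB y σ} (1 − nat u i)`. [folklore] -/
def FailB (y : List Bool) (σ : Bool) (i : ℕ) : ℝ := ∑ u ∈ C.fibB y σ, (1 - C.nat u.toList i)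

/-- The level ratio `x = |fib y| / 2^{i + eLen N}`. [folklore] -/
def xl (y : List Bool) (i : ℕ) : ℝ := (C.fib y).card / 2 ^ C.pfx i

/-- The bit-`1` fraction of the fibre, `π₁ = |fibB y 1| / |fib y|`. [folklore] -/
def π1 (y : List Bool) : ℝ := (C.fibB y true).card / (C.fib y).card

/-! ### Elementary facts -/

/-- Membership in the fibre. [folklore] -/
theorem mem_fib {y : List Bool} {u : List.Vector Bool C.rl} : u ∈ C.fib y ↔ C.P.ftil (C.xu u.toList) = y := by simp [fib]

/-- Membership in a half fibre. [folklore] -/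
theorem mem_fibB {y : List Bool} {σ : Bool} {u : List.Vector Bool C.rl} :
    u ∈ C.fibB y σ ↔ C.P.ftil (C.xu u.toList) = y ∧ Params.sgR u.toList = σ := by simp [fibB, fib]

/-- `fibB y σ ⊆ fib y`. [folklore] -/
theorem fibB_subset (y : List Bool) (σ : Bool) : C.fibB y σ ⊆ C.fib y := Finset.filter_subset _ _

/-- The two halves partition the fibre. [folklore] -/
theorem card_fibB_add (y : List Bool) : (C.fibB y false).card + (C.fibB y true).card = (C.fib y).card := by
  have hB : C.fibB y true = (C.fib y).filter (fun u => ¬ (Params.sgR u.toList = false)) :=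
    Finset.filter_congr fun u _ => by cases Params.sgR u.toList <;> simp
  rw [hB, fibB]
  exact Finset.card_filter_add_card_filter_not _

/-- The natural query is the genuine input `⟨1^m, F(sp ‖ u ‖ ι_i ‖ ρ)⟩`. [folklore] -/
theorem WF.natQ_eq (h : C.WF) {u ρ : List Bool} (hu : u.length = C.rl) (hρ : ρ.length = C.klen) {i : ℕ} (hi : i ≤ C.L) :
    C.natQ u i ρ = boolPair (unaryEncodeNat C.m) (C.P.F (C.xu u ++ C.ιb i ++ ρ)) :=
  (h.pair_F_nat (h.length_xu hu) hρ hi).symm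

/-- `0 ≤ sInd`. [folklore] -/
theorem sInd_nonneg (y : List Bool) (i : ℕ) (σ : Bool) (α ρ rA : List Bool) : 0 ≤ C.sInd y i σ α ρ rA := by
  unfold sInd; split_ifs <;> norm_num
/-- `sInd ≤ 1`. [folklore] -/
theorem sInd_le_one (y : List Bool) (i : ℕ) (σ : Bool) (α ρ rA : List Bool) : C.sInd y i σ α ρ rA ≤ 1 := by
  unfold sInd; split_ifs <;> norm_num
/-- `0 ≤ s`. [folklore] -/
theorem s_nonneg (y : List Bool) (i : ℕ) (σ : Bool) : 0 ≤ C.s y i σ :=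
  uniformAvg_nonneg fun _ => uniformAvg_nonneg fun _ => uniformAvg_nonneg fun _ => C.sInd_nonneg ..
/-- `ret ≤ 1`. [folklore] -/
theorem ret_le_one (u : List Bool) (i : ℕ) : C.ret u i ≤ 1 :=
  uniformAvg_le_one fun _ => uniformAvg_le_one fun _ => by split_ifs <;> norm_num
/-- `0 ≤ ret`. [folklore] -/
theorem ret_nonneg (u : List Bool) (i : ℕ) : 0 ≤ C.ret u i :=
  uniformAvg_nonneg fun _ => uniformAvg_nonneg fun _ => by split_ifs <;> norm_num
/-- `nat ≤ 1`. [folklore] -/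
theorem nat_le_one (u : List Bool) (i : ℕ) : C.nat u i ≤ 1 :=
  uniformAvg_le_one fun _ => uniformAvg_le_one fun _ => by split_ifs <;> norm_num
/-- `0 ≤ nat`. [folklore] -/
theorem nat_nonneg (u : List Bool) (i : ℕ) : 0 ≤ C.nat u i :=
  uniformAvg_nonneg fun _ => uniformAvg_nonneg fun _ => by split_ifs <;> norm_num
/-- `0 ≤ coll`. [folklore] -/
theorem coll_nonneg (y u : List Bool) (i : ℕ) : 0 ≤ C.coll y u i := uniformAvg_nonneg fun _ => by split_ifs <;> norm_num
/-- `0 ≤ Fail`. [folklore] -/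
theorem Fail_nonneg (y : List Bool) (i : ℕ) : 0 ≤ C.Fail y i := Finset.sum_nonneg fun _ _ => sub_nonneg.2 (C.nat_le_one _ _)
/-- `0 ≤ FailB`. [folklore] -/
theorem FailB_nonneg (y : List Bool) (σ : Bool) (i : ℕ) : 0 ≤ C.FailB y σ i :=
  Finset.sum_nonneg fun _ _ => sub_nonneg.2 (C.nat_le_one _ _)

/-- `FailB 0 + FailB 1 = Fail`. [folklore] -/
theorem FailB_add (y : List Bool) (i : ℕ) : C.FailB y false i + C.FailB y true i = C.Fail y i := by
  have hB : C.fibB y true = (C.fib y).filter (fun u => ¬ (Params.sgR u.toList = false)) :=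
    Finset.filter_congr fun u _ => by cases Params.sgR u.toList <;> simp
  unfold FailB Fail
  rw [hB, fibB]
  exact Finset.sum_filter_add_sum_filter_not _ _ _

/-- `FailB σ ≤ Fail`. [folklore] -/
theorem FailB_le (y : List Bool) (σ : Bool) (i : ℕ) : C.FailB y σ i ≤ C.Fail y i := by
  have h := C.FailB_add y i
  have h0 := C.FailB_nonneg y false i
  have h1 := C.FailB_nonneg y true i
  cases σ <;> linarith

/-- A uniform average of a difference (private copy of `uniformAvg_sub'`, `CommitmentOneWay.lean`). [folklore] -/
private theorem uniformAvg_sub' (k : ℕ) (f g : List Bool → ℝ) :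
    uniformAvg k (fun x => f x - g x) = uniformAvg k f - uniformAvg k g := by
  unfold uniformAvg; rw [Finset.sum_sub_distrib, sub_div]
/-- `0 ≤ xl`. [folklore] -/
theorem xl_nonneg (y : List Bool) (i : ℕ) : 0 ≤ C.xl y i := by unfold xl; positivity

/-- `π₁ ∈ [0, 1]` (the fibre of a slice image is nonempty). [folklore] -/
theorem π1_mem {y : List Bool} {u₀ : List.Vector Bool C.rl} (hy : C.P.ftil (C.xu u₀.toList) = y) : 0 ≤ C.π1 y ∧ C.π1 y ≤ 1 := by
  have hpos : 0 < (C.fib y).card := Finset.card_pos.2 ⟨u₀, C.mem_fib.2 hy⟩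
  have hle : (C.fibB y true).card ≤ (C.fib y).card := Finset.card_le_card (C.fibB_subset y true)
  unfold π1
  constructor
  · positivity
  · rw [div_le_one (by exact_mod_cast hpos)]; exact_mod_cast hle

/-- The two selector events are disjoint: `sInd … 0 + sInd … 1 ≤ 1`, so `p ≤ 1`. [folklore] -/
theorem sInd_add_le_one (y : List Bool) (i : ℕ) (α ρ rA : List Bool) : C.sInd y i false α ρ rA + C.sInd y i true α ρ rA ≤ 1 := by
  unfold sInd
  cases C.outBit (C.ans y i α ρ rA) <;> by_cases hv : C.Valid y i α ρ rA <;> simp [hv]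

/-- A uniform average of a sum. [folklore] -/
private theorem uniformAvg_add_distrib (k : ℕ) (f g : List Bool → ℝ) :
    uniformAvg k (fun x => f x + g x) = uniformAvg k f + uniformAvg k g := by
  unfold uniformAvg; rw [Finset.sum_add_distrib, add_div]

/-- `p y i = E[sInd 0 + sInd 1] ≤ 1`. [folklore] -/
theorem p_le_one (y : List Bool) (i : ℕ) : C.p y i ≤ 1 := by
  unfold p s
  rw [← uniformAvg_add_distrib]
  refine uniformAvg_le_one fun ρ => ?_
  rw [← uniformAvg_add_distrib]
  refine uniformAvg_le_one fun α => ?_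
  rw [← uniformAvg_add_distrib]
  exact uniformAvg_le_one fun rA => C.sInd_add_le_one y i α ρ rA

/-- An average of an indicator is a normalised count. [folklore] -/
theorem uniformAvg_indicator (k : ℕ) (E : List Bool → Prop) [DecidablePred E] :
    uniformAvg k (fun x => if E x then (1 : ℝ) else 0) = ((univ.filter fun v : List.Vector Bool k => E v.toList).card : ℝ) / 2 ^ k := by
  unfold uniformAvg
  rw [Finset.sum_boole]

/-- Strings of length `H` with a prescribed `T`-prefix: exactly `2^{H − T}` of them (`T ≤ H`). [folklore] -/
theorem card_filter_take_eq {H T : ℕ} (hT : T ≤ H) {μ : List Bool} (hμ : μ.length = H) :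
    ((univ : Finset (List.Vector Bool H)).filter fun α => α.toList.take T = μ.take T).card = 2 ^ (H - T) := by
  refine le_antisymm ?_ (by simpa [min_eq_left hT] using card_prefix_ge (k := T) hμ)
  -- `α ↦ α ⇂ T` is injective on the class
  have hinj : Set.InjOn (fun α : List.Vector Bool H => (⟨α.toList.drop T, by simp⟩ : List.Vector Bool (H - T)))
      ↑((univ : Finset (List.Vector Bool H)).filter fun α => α.toList.take T = μ.take T) := by
    intro α hα α' hα' heq
    simp only [Finset.coe_filter, Finset.mem_univ, true_and, Set.mem_setOf_eq] at hα hα'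
    have hd : α.toList.drop T = α'.toList.drop T := by simpa using congrArg List.Vector.toList heq
    apply List.Vector.toList_injective
    rw [← List.take_append_drop T α.toList, ← List.take_append_drop T α'.toList, hα, hα', hd]
  calc ((univ : Finset (List.Vector Bool H)).filter fun α => α.toList.take T = μ.take T).card
      ≤ (univ : Finset (List.Vector Bool (H - T))).card := Finset.card_le_card_of_injOn _ (fun _ _ => Finset.mem_univ _) hinj
    _ = 2 ^ (H - T) := by rw [Finset.card_univ, card_vector, Fintype.card_bool]

/-! ### The counting identity -/

section Counting

variable (h : C.WF) {y : List Bool} {i : ℕ} (hi : i ≤ C.L) {σ : Bool}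
include h hi

omit hi in
/-- A slice image has length `L`. [folklore] -/
theorem WF.length_y {u₀ : List.Vector Bool C.rl} (hy : C.P.ftil (C.xu u₀.toList) = y) : y.length = C.L := by
  rw [← hy, length_ftil (h.length_xu u₀.toList_length)]

/-- **Structure of a valid answer with bit `σ`** (for `y` a slice image, `|α| = hLen N`, `|ρ| = klen`): it comes
from a fibre element `u'` with bit `σ` that `A` returns on its natural query and whose hash prefix is that of `α`.
[folklore] -/
theorem WF.valid_iff {u₀ : List.Vector Bool C.rl} (hy : C.P.ftil (C.xu u₀.toList) = y) {α ρ rA : List Bool}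
    (hα : α.length = hLen C.N) (hρ : ρ.length = C.klen) :
    (C.Valid y i α ρ rA ∧ C.outBit (C.ans y i α ρ rA) = σ) ↔
      ∃ u' ∈ C.fibB y σ, C.Returns u'.toList i ρ rA ∧ α.take (C.pfx i) = (C.hρ ρ (C.xu u'.toList)).take (C.pfx i) := by
  have hyl := h.length_y hy
  constructor
  · rintro ⟨hv, hb⟩
    obtain ⟨x', hx', hans, hfx, hpre⟩ := (h.F_eq_body_iff hyl hα hρ hi).1 hv
    have hx'u : x' = C.xu (x'.drop (2 * C.t)) := h.eq_xu_of_ftil_eq u₀.toList_length hx' (hfx.trans hy.symm)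
    have hul : (x'.drop (2 * C.t)).length = C.rl := by rw [List.length_drop, hx']; rfl
    let u' : List.Vector Bool C.rl := ⟨x'.drop (2 * C.t), hul⟩
    have hu't : u'.toList = x'.drop (2 * C.t) := rfl
    have hq : C.qry y i α ρ = C.natQ u'.toList i ρ := by
      rw [natQ, hu't, ← hx'u, hfx]; exact h.qry_eq_of_take_eq hi hpre.symm
    refine ⟨u', ?_, ?_, ?_⟩
    · rw [mem_fibB, hu't, ← hx'u]
      refine ⟨hfx, ?_⟩
      rw [← hb, hans]
      conv_rhs => rw [hx'u, List.append_assoc]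
      exact (h.outBit_xu hul _).symm
    · rw [Returns, ← hq, hu't, ← hx'u]; exact hans
    · rw [hu't, ← hx'u]; exact hpre.symm
  · rintro ⟨u', hu', hret, hpre⟩
    obtain ⟨hfu, hsg⟩ := C.mem_fibB.1 hu'
    have hq : C.qry y i α ρ = C.natQ u'.toList i ρ := by rw [natQ, hfu]; exact h.qry_eq_of_take_eq hi hpre
    have hans : C.ans y i α ρ rA = C.xu u'.toList ++ C.ιb i ++ ρ := by rw [ans, hq]; exact hret
    refine ⟨?_, ?_⟩
    · rw [Valid, hans]
      exact (h.F_eq_body_iff hyl hα hρ hi).2 ⟨C.xu u'.toList, h.length_xu u'.toList_length, rfl, hfu, hpre.symm⟩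
    · rw [hans, List.append_assoc, h.outBit_xu u'.toList_length, hsg]

/-- Distinct returned fibre elements have distinct hash prefixes (same query ⇒ same answer). [folklore] -/
theorem WF.take_ne_of_returns {u u' : List.Vector Bool C.rl} (hu : u ∈ C.fib y) (hu' : u' ∈ C.fib y) {ρ rA : List Bool}
    (hr : C.Returns u.toList i ρ rA) (hr' : C.Returns u'.toList i ρ rA) (hne : u ≠ u') :
    (C.hρ ρ (C.xu u.toList)).take (C.pfx i) ≠ (C.hρ ρ (C.xu u'.toList)).take (C.pfx i) := by
  intro heq
  apply hne
  have hq : C.natQ u.toList i ρ = C.natQ u'.toList i ρ := by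
    rw [natQ, natQ, C.mem_fib.1 hu, C.mem_fib.1 hu']; exact h.qry_eq_of_take_eq hi heq
  rw [Returns, hq] at hr
  have := hr.symm.trans hr'
  rw [List.append_assoc, List.append_assoc, xu, xu, List.append_assoc, List.append_assoc] at this
  exact List.Vector.toList_injective (List.append_cancel_right (List.append_cancel_left this))

/-- **The count for a fixed key and fixed coins**: the valid targets with bit `σ` are the disjoint union, over the
returned elements `u'` of `fibB y σ`, of the prefix classes of `h_ρ(sp ‖ u')`, each of size `2^{hLen N − (i + eLen N)}`.
[cite: HastadImpagliazzoLevinLuby1999, Lemma 5.1.2 (1) (proof: the prefix count)] -/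
theorem WF.sum_sInd_eq {u₀ : List.Vector Bool C.rl} (hy : C.P.ftil (C.xu u₀.toList) = y) {ρ : List Bool} (hρ : ρ.length = C.klen)
    (rA : List Bool) :
    (∑ α : List.Vector Bool (hLen C.N), C.sInd y i σ α.toList ρ rA) =
      2 ^ (hLen C.N - C.pfx i) * (((C.fibB y σ).filter fun u' => C.Returns u'.toList i ρ rA).card : ℝ) := by
  set Ret := (C.fibB y σ).filter fun u' => C.Returns u'.toList i ρ rA with hRet
  set Cls : List.Vector Bool C.rl → Finset (List.Vector Bool (hLen C.N)) :=
    fun u' => univ.filter fun α => α.toList.take (C.pfx i) = (C.hρ ρ (C.xu u'.toList)).take (C.pfx i) with hCls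
  have hT : C.pfx i ≤ hLen C.N := h.pfx_le hi
  -- the valid set is the union of the classes
  have hset : (univ.filter fun α : List.Vector Bool (hLen C.N) => C.Valid y i α.toList ρ rA ∧ C.outBit (C.ans y i α.toList ρ rA) = σ) =
      Ret.biUnion Cls := by
    ext α
    simp only [Finset.mem_filter, Finset.mem_univ, true_and, Finset.mem_biUnion, hRet, hCls]
    rw [h.valid_iff hi hy α.toList_length hρ]
    constructor
    · rintro ⟨u', hu', hr, hp⟩; exact ⟨u', ⟨hu', hr⟩, hp⟩
    · rintro ⟨u', ⟨hu', hr⟩, hp⟩; exact ⟨u', hu', hr, hp⟩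
  have hdisj : (↑Ret : Set (List.Vector Bool C.rl)).PairwiseDisjoint Cls := by
    intro u hu u' hu' hne
    rw [Function.onFun, Finset.disjoint_left]
    intro α hα hα'
    simp only [hCls, Finset.mem_filter, Finset.mem_univ, true_and] at hα hα'
    have hum := (Finset.mem_filter.1 hu); have hum' := (Finset.mem_filter.1 hu')
    exact h.take_ne_of_returns hi (C.fibB_subset y σ hum.1) (C.fibB_subset y σ hum'.1) hum.2 hum'.2 hne (hα.symm.trans hα')
  have hcard : ∀ u' ∈ Ret, (Cls u').card = 2 ^ (hLen C.N - C.pfx i) := fun u' _ => card_filter_take_eq hT (length_hρ ..)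
  have hsum : (∑ α : List.Vector Bool (hLen C.N), C.sInd y i σ α.toList ρ rA) =
      ((univ.filter fun α : List.Vector Bool (hLen C.N) => C.Valid y i α.toList ρ rA ∧ C.outBit (C.ans y i α.toList ρ rA) = σ).card : ℝ) := by
    unfold sInd; rw [Finset.sum_boole]
  rw [hsum, hset, Finset.card_biUnion hdisj, Finset.sum_congr rfl hcard, Finset.sum_const, smul_eq_mul]
  push_cast
  ring

/-- **The identity** `s y i σ = 2^{-(i + eLen N)} · Σ_{u ∈ fibB y σ} ret u i` (valid for `y` a slice image).
[cite: Goldreich2001, Ch. 2 Exercise 17 (guideline)] -/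
theorem WF.s_eq {u₀ : List.Vector Bool C.rl} (hy : C.P.ftil (C.xu u₀.toList) = y) :
    C.s y i σ = (∑ u' ∈ C.fibB y σ, C.ret u'.toList i) / 2 ^ C.pfx i := by
  have hT : C.pfx i ≤ hLen C.N := h.pfx_le hi
  have h2 : (2 : ℝ) ^ hLen C.N = 2 ^ (hLen C.N - C.pfx i) * 2 ^ C.pfx i := by rw [← pow_add, Nat.sub_add_cancel hT]
  unfold s ret
  -- count the targets for fixed key and coins
  have hinner : ∀ ρ : List Bool, ρ.length = C.klen →
      uniformAvg (hLen C.N) (fun α => uniformAvg C.κ fun rA => C.sInd y i σ α ρ rA) =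
        uniformAvg C.κ fun rA => (∑ u' ∈ C.fibB y σ, if C.Returns u'.toList i ρ rA then (1 : ℝ) else 0) / 2 ^ C.pfx i := by
    intro ρ hρ
    rw [uniformAvg_comm]
    refine uniformAvg_congr fun rA _ => ?_
    unfold uniformAvg
    rw [h.sum_sInd_eq hi hy hρ rA, Finset.sum_boole, h2, mul_div_mul_left _ _ (by positivity)]
  rw [uniformAvg_congr hinner]
  -- pull the finite sum out of the two averages
  have hpull : ∀ ρ : List Bool, uniformAvg C.κ (fun rA => (∑ u' ∈ C.fibB y σ, if C.Returns u'.toList i ρ rA then (1 : ℝ) else 0) / 2 ^ C.pfx i) =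
      (∑ u' ∈ C.fibB y σ, uniformAvg C.κ fun rA => if C.Returns u'.toList i ρ rA then (1 : ℝ) else 0) / 2 ^ C.pfx i := by
    intro ρ
    rw [← uniformAvg_finset_sum]
    unfold uniformAvg
    rw [Finset.sum_div, Finset.sum_div, Finset.sum_div]
    refine Finset.sum_congr rfl fun rA _ => ?_
    ring
  rw [uniformAvg_congr fun ρ _ => hpull ρ, ← uniformAvg_finset_sum]
  unfold uniformAvg
  rw [Finset.sum_div, Finset.sum_div, Finset.sum_div]
  refine Finset.sum_congr rfl fun ρ _ => ?_
  ring

/-- **Upper bound**: `s y i σ ≤ |fibB y σ| / 2^{i + eLen N}`. [folklore] -/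
theorem WF.s_le {u₀ : List.Vector Bool C.rl} (hy : C.P.ftil (C.xu u₀.toList) = y) :
    C.s y i σ ≤ (C.fibB y σ).card / 2 ^ C.pfx i := by
  rw [h.s_eq hi hy]
  refine div_le_div_of_nonneg_right ?_ (by positivity)
  calc (∑ u' ∈ C.fibB y σ, C.ret u'.toList i) ≤ ∑ _u' ∈ C.fibB y σ, (1 : ℝ) := Finset.sum_le_sum fun u' _ => C.ret_le_one _ _
    _ = (C.fibB y σ).card := by simp

end Counting

/-! ### The lower bound on `ret` -/

section Lower

variable (h : C.WF) {i : ℕ} (hi : i ≤ C.L)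
include h hi

/-- **If `A` inverts and no other fibre element shares `u`'s prefix, the answer is `u` itself.** Hence
`ret u i ≥ nat u i − coll y u i` (`y = f̃(sp ‖ u)`). [cite: Goldreich2001, Ch. 2 Exercise 17 (guideline)] -/
theorem WF.nat_sub_coll_le_ret (u : List.Vector Bool C.rl) :
    C.nat u.toList i - C.coll (C.P.ftil (C.xu u.toList)) u.toList i ≤ C.ret u.toList i := by
  have hyl : (C.P.ftil (C.xu u.toList)).length = C.L := length_ftil (h.length_xu u.toList_length)
  unfold nat coll ret
  rw [← uniformAvg_sub']
  refine uniformAvg_mono fun ρ hρ => ?_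
  by_cases hc : C.Coll (C.P.ftil (C.xu u.toList)) u.toList i ρ
  · rw [if_pos hc]
    have h1 : uniformAvg C.κ (fun rA => if C.Inverts u.toList i ρ rA then (1 : ℝ) else 0) ≤ 1 :=
      uniformAvg_le_one fun _ => by split_ifs <;> norm_num
    have h2 : 0 ≤ uniformAvg C.κ (fun rA => if C.Returns u.toList i ρ rA then (1 : ℝ) else 0) :=
      uniformAvg_nonneg fun _ => by split_ifs <;> norm_num
    linarith
  · rw [if_neg hc, sub_zero]
    refine uniformAvg_mono fun rA _ => ?_
    by_cases hinv : C.Inverts u.toList i ρ rA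
    · -- an inverting answer is a returned answer
      have hret : C.Returns u.toList i ρ rA := by
        have hv : C.P.F (C.A.run (C.natQ u.toList i ρ) rA) = body C.N (C.P.ftil (C.xu u.toList)) (C.ιb i) (C.hρ ρ (C.xu u.toList)) ρ := by
          rw [Inverts, h.F_nat (h.length_xu u.toList_length) hρ hi] at hinv; exact hinv
        obtain ⟨x', hx', hans, hfx, hpre⟩ := (h.F_eq_body_iff hyl (length_hρ ..) hρ hi).1 hv
        have hx'u : x' = C.xu (x'.drop (2 * C.t)) := h.eq_xu_of_ftil_eq u.toList_length hx' hfx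
        have hul : (x'.drop (2 * C.t)).length = C.rl := by rw [List.length_drop, hx']; rfl
        -- the element `x' ⇂ 2t` of the fibre must be `u`, else a collision
        have heq : x'.drop (2 * C.t) = u.toList := by
          by_contra hne
          apply hc
          refine ⟨⟨x'.drop (2 * C.t), hul⟩, ?_, hne, ?_⟩
          · rw [mem_fib]; show C.P.ftil (C.xu (x'.drop (2 * C.t))) = _; rw [← hx'u]; exact hfx
          · show (C.hρ ρ (C.xu (x'.drop (2 * C.t)))).take (C.pfx i) = _; rw [← hx'u]; exact hpre
        rw [Returns, hans, hx'u, heq]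
      rw [if_pos hinv, if_pos hret]
    · rw [if_neg hinv]; split_ifs <;> norm_num

end Lower

/-! ### The collision bound (pairwise independence of the hash prefixes) -/

section Collision

omit C in
/-- `(encZ k v) ↾ T = (encZ k w) ↾ T` iff the `T`-prefixes of `v, w ∈ 𝔽₂^k` agree (`T ≤ k`). [folklore] -/
theorem take_encZ_eq_iff {k T : ℕ} (hT : T ≤ k) (v w : Fin k → ZMod 2) :
    (encZ k v).take T = (encZ k w).take T ↔ HHRVW.prefixZ T v = HHRVW.prefixZ T w := by
  have hlen : ∀ v : Fin k → ZMod 2, ((encZ k v).take T).length = T := fun v => by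
    rw [List.length_take, length_encZ, min_eq_left hT]
  have hget : ∀ (v : Fin k → ZMod 2) (j : ℕ) (hj : j < T),
      ((encZ k v).take T)[j]'(by rw [hlen]; exact hj) = decide (v ⟨j, by omega⟩ = 1) := by
    intro v j hj
    rw [List.getElem_take]
    simp [encZ]
  rw [HHRVW.prefixZ_eq_iff]
  constructor
  · intro he j hj
    have h1 := hget v j hj
    have h2 := hget w j hj
    have h3 : ((encZ k v).take T)[j.val]'(by rw [hlen]; exact hj) = ((encZ k w).take T)[j.val]'(by rw [hlen]; exact hj) := by
      simp only [he]
    rw [h1, h2] at h3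
    rw [← bz_decide (v j), ← bz_decide (w j)]
    exact congrArg Complexity.Stockmeyer.bz h3
  · intro he
    refine List.ext_getElem (by rw [hlen, hlen]) fun j hj _ => ?_
    have hj' : j < T := by rw [hlen] at hj; exact hj
    rw [hget v j hj', hget w j hj', he ⟨j, by omega⟩ hj']

omit C in
/-- **Prefix agreement probability `2^{-T}`**: for distinct `x, x' ∈ {0,1}^{Lx}`, hash length `H`, `T ≤ H` and keys
`ρ ∈ {0,1}^K` with `K ≥ H (Lx + 1)`, the keys under which `h_ρ(x')` and `h_ρ(x)` have the same `T`-prefix are exactly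
a `2^{-T}` fraction. [cite: AroraBarak2009, Def. 8.14 (pairwise independence), via `card_filter_prefixZ_agree_mul`] -/
theorem uniformAvg_take_hashStr_eq {Lx H K T : ℕ} (hT : T ≤ H) (hK : H * (Lx + 1) ≤ K) {x x' : List Bool}
    (hx : x.length = Lx) (hx' : x'.length = Lx) (hne : x ≠ x') :
    uniformAvg K (fun ρ => if (hashStr Lx H ρ x').take T = (hashStr Lx H ρ x).take T then (1 : ℝ) else 0) = 1 / 2 ^ T := by
  subst hx
  have hvne : (⟨x, rfl⟩ : List.Vector Bool x.length) ≠ ⟨x', hx'⟩ := fun he => hne (congrArg List.Vector.toList he)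
  have hcount := HHRVW.card_filter_prefixZ_agree_mul (K := List.Vector Bool K) hT
    (fun ρ => hashV x.length H ρ.toList ⟨x, rfl⟩) (fun ρ => hashV x.length H ρ.toList ⟨x', hx'⟩)
    (fun z z' => by rw [card_vector, Fintype.card_bool]; exact card_filter_hashV_pair hK hvne z z')
  rw [card_vector, Fintype.card_bool] at hcount
  have hfilter : (univ.filter fun ρ : List.Vector Bool K => (hashStr x.length H ρ.toList x').take T = (hashStr x.length H ρ.toList x).take T) =
      (univ.filter fun ρ : List.Vector Bool K =>
        HHRVW.prefixZ T (hashV x.length H ρ.toList ⟨x', hx'⟩) = HHRVW.prefixZ T (hashV x.length H ρ.toList ⟨x, rfl⟩)) := by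
    refine Finset.filter_congr fun ρ _ => ?_
    have e1 : hashStr x.length H ρ.toList x = encZ H (hashV x.length H ρ.toList ⟨x, rfl⟩) := hashStr_toList _ _ _ ⟨x, rfl⟩
    have e2 : hashStr x.length H ρ.toList x' = encZ H (hashV x.length H ρ.toList ⟨x', hx'⟩) := hashStr_toList _ _ _ ⟨x', hx'⟩
    rw [e1, e2, take_encZ_eq_iff hT]
  have hc : (((univ.filter fun ρ : List.Vector Bool K =>
      HHRVW.prefixZ T (hashV x.length H ρ.toList ⟨x', hx'⟩) = HHRVW.prefixZ T (hashV x.length H ρ.toList ⟨x, rfl⟩)).card : ℝ)) *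
      2 ^ T = 2 ^ K := by exact_mod_cast hcount
  rw [uniformAvg_indicator, hfilter, div_eq_div_iff (by positivity) (by positivity), one_mul, hc]

/-- The instance for the context: keys of length `klen ≥ hLen N (L + 1)`. [folklore] -/
theorem WF.uniformAvg_take_hρ_eq (h : C.WF) {T : ℕ} (hT : T ≤ hLen C.N) {x x' : List Bool} (hx : x.length = C.L)
    (hx' : x'.length = C.L) (hne : x ≠ x') :
    uniformAvg C.klen (fun ρ => if (C.hρ ρ x').take T = (C.hρ ρ x).take T then (1 : ℝ) else 0) = 1 / 2 ^ T :=
  uniformAvg_take_hashStr_eq hT h.hLen_mul_le_klen hx hx' hne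

omit C in
/-- Union bound for an indicator of an existential over a finite set. [folklore] -/
theorem ite_exists_le_sum {ι : Type*} (S : Finset ι) (Q : ι → Prop) [DecidablePred Q] [Decidable (∃ a ∈ S, Q a)] :
    (if ∃ a ∈ S, Q a then (1 : ℝ) else 0) ≤ ∑ a ∈ S, if Q a then (1 : ℝ) else 0 := by
  split_ifs with hex
  · obtain ⟨a, ha, hQ⟩ := hex
    refine le_trans (le_of_eq (if_pos hQ).symm) (Finset.single_le_sum (f := fun a => if Q a then (1 : ℝ) else 0)
      (fun _ _ => by split_ifs <;> norm_num) ha)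
  · exact Finset.sum_nonneg fun _ _ => by split_ifs <;> norm_num

variable (h : C.WF) {y : List Bool} {i : ℕ} (hi : i ≤ C.L)
include h hi

/-- **The collision bound**: `coll y u i ≤ (|fib y| − 1) / 2^{i + eLen N}` for `u ∈ fib y` (union bound over the other
fibre elements, each colliding with probability `2^{-(i+eLen N)}`). [folklore] -/
theorem WF.coll_le {u : List.Vector Bool C.rl} (hu : u ∈ C.fib y) :
    C.coll y u.toList i ≤ ((C.fib y).card - 1 : ℝ) / 2 ^ C.pfx i := by
  have hT : C.pfx i ≤ hLen C.N := h.pfx_le hi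
  calc C.coll y u.toList i
      ≤ uniformAvg C.klen (fun ρ => ∑ u' ∈ (C.fib y).erase u,
          if (C.hρ ρ (C.xu u'.toList)).take (C.pfx i) = (C.hρ ρ (C.xu u.toList)).take (C.pfx i) then (1 : ℝ) else 0) := by
        unfold coll
        refine uniformAvg_mono fun ρ _ => le_trans ?_ (ite_exists_le_sum ((C.fib y).erase u)
          (fun u' => (C.hρ ρ (C.xu u'.toList)).take (C.pfx i) = (C.hρ ρ (C.xu u.toList)).take (C.pfx i)))
        by_cases hc : C.Coll y u.toList i ρ
        · have hex : ∃ u' ∈ (C.fib y).erase u, (C.hρ ρ (C.xu u'.toList)).take (C.pfx i) = (C.hρ ρ (C.xu u.toList)).take (C.pfx i) := by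
            obtain ⟨u', hu', hne, hpre⟩ := hc
            exact ⟨u', Finset.mem_erase.2 ⟨fun he => hne (by rw [he]), hu'⟩, hpre⟩
          rw [if_pos hc, if_pos hex]
        · rw [if_neg hc]; split_ifs <;> norm_num
    _ = ∑ u' ∈ (C.fib y).erase u, uniformAvg C.klen (fun ρ =>
          if (C.hρ ρ (C.xu u'.toList)).take (C.pfx i) = (C.hρ ρ (C.xu u.toList)).take (C.pfx i) then (1 : ℝ) else 0) :=
        uniformAvg_finset_sum _ _
    _ = ∑ _u' ∈ (C.fib y).erase u, (1 : ℝ) / 2 ^ C.pfx i := by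
        refine Finset.sum_congr rfl fun u' hu' => ?_
        have hne : u' ≠ u := (Finset.mem_erase.1 hu').1
        exact h.uniformAvg_take_hρ_eq hT (h.length_xu u.toList_length) (h.length_xu u'.toList_length)
          (fun he => hne (List.Vector.toList_injective (List.append_cancel_left he)).symm)
    _ = ((C.fib y).card - 1 : ℝ) / 2 ^ C.pfx i := by
        rw [Finset.sum_const, Finset.card_erase_of_mem hu, nsmul_eq_mul]
        have : 1 ≤ (C.fib y).card := Finset.card_pos.2 ⟨u, hu⟩
        push_cast [Nat.cast_sub this]
        ring

end Collision

/-! ### The level estimates consumed by the scan analysis -/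

section Level

variable (h : C.WF) {y : List Bool} {i : ℕ} (hi : i ≤ C.L) {u₀ : List.Vector Bool C.rl} (hy : C.P.ftil (C.xu u₀.toList) = y)
include h hi hy

/-- **Lower bound on `s`**: `s y i σ ≥ (|fibB y σ| − FailB(y,σ,i) − |fibB y σ| (|fib y| − 1)/2^{pfx}) / 2^{pfx}`. [folklore] -/
theorem WF.s_ge {σ : Bool} :
    ((C.fibB y σ).card - C.FailB y σ i - (C.fibB y σ).card * (((C.fib y).card - 1) / 2 ^ C.pfx i)) / 2 ^ C.pfx i ≤ C.s y i σ := by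
  rw [h.s_eq hi hy]
  refine div_le_div_of_nonneg_right ?_ (by positivity)
  have hsub := C.fibB_subset y σ
  have h1 : ∑ u' ∈ C.fibB y σ, (C.nat u'.toList i - C.coll y u'.toList i) ≤ ∑ u' ∈ C.fibB y σ, C.ret u'.toList i :=
    Finset.sum_le_sum fun u' hu' => by
      have := h.nat_sub_coll_le_ret hi u'
      rw [C.mem_fib.1 (hsub hu')] at this
      exact this
  have h2 : ∑ u' ∈ C.fibB y σ, C.coll y u'.toList i ≤ (C.fibB y σ).card * (((C.fib y).card - 1) / 2 ^ C.pfx i) := by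
    calc ∑ u' ∈ C.fibB y σ, C.coll y u'.toList i ≤ ∑ _u' ∈ C.fibB y σ, ((C.fib y).card - 1 : ℝ) / 2 ^ C.pfx i :=
          Finset.sum_le_sum fun u' hu' => h.coll_le hi (hsub hu')
      _ = _ := by rw [Finset.sum_const, nsmul_eq_mul]
  have h3 : (C.fibB y σ).card - C.FailB y σ i = ∑ u' ∈ C.fibB y σ, C.nat u'.toList i := by
    unfold FailB
    rw [Finset.sum_sub_distrib]; simp
  rw [Finset.sum_sub_distrib] at h1
  linarith

/-- **`p ≥ x − Fail/2^{pfx} − x²`** with `x = |fib y|/2^{pfx}`. [folklore] -/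
theorem WF.p_ge : C.xl y i - C.Fail y i / 2 ^ C.pfx i - C.xl y i ^ 2 ≤ C.p y i := by
  have h0 := h.s_ge hi hy (σ := false)
  have h1 := h.s_ge hi hy (σ := true)
  have hc : ((C.fibB y false).card : ℝ) + (C.fibB y true).card = (C.fib y).card := by exact_mod_cast C.card_fibB_add y
  have hFB := C.FailB_add y i
  have hpow : (0 : ℝ) < 2 ^ C.pfx i := by positivity
  set T2 : ℝ := 2 ^ C.pfx i with hT2
  have key : ((C.fibB y false).card - C.FailB y false i - (C.fibB y false).card * (((C.fib y).card - 1) / T2)) / T2 +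
      ((C.fibB y true).card - C.FailB y true i - (C.fibB y true).card * (((C.fib y).card - 1) / T2)) / T2 =
      (C.fib y).card / T2 - C.Fail y i / T2 - ((C.fib y).card / T2) ^ 2 + ((C.fib y).card / T2) / T2 := by
    rw [← hc, ← hFB]
    field_simp
    ring
  have hextra : 0 ≤ ((C.fib y).card / T2) / T2 := by positivity
  unfold p xl
  linarith

/-- **The bias bound**: `|s y i 1 − p y i · π₁| ≤ Fail/2^{pfx} + x²`. [folklore] -/
theorem WF.abs_bias_le : |C.s y i true - C.p y i * C.π1 y| ≤ C.Fail y i / 2 ^ C.pfx i + C.xl y i ^ 2 := by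
  have hup := h.s_le hi hy (σ := true)
  have hup0 := h.s_le hi hy (σ := false)
  have hlo := h.s_ge hi hy (σ := true)
  have hp := h.p_ge hi hy
  obtain ⟨hπ0, hπ1⟩ := C.π1_mem hy
  have hpos : 0 < ((C.fib y).card : ℝ) := by exact_mod_cast Finset.card_pos.2 ⟨u₀, C.mem_fib.2 hy⟩
  have hc : ((C.fibB y false).card : ℝ) + (C.fibB y true).card = (C.fib y).card := by exact_mod_cast C.card_fibB_add y
  have hF := C.Fail_nonneg y i
  have hF1 := C.FailB_le y true i
  have hpow : (0 : ℝ) < 2 ^ C.pfx i := by positivity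
  set T2 : ℝ := 2 ^ C.pfx i with hT2
  -- `|fibB 1| = π₁ |fib|`
  have hN1 : ((C.fibB y true).card : ℝ) = C.π1 y * (C.fib y).card := by
    unfold π1; field_simp
  have hxπ : ((C.fibB y true).card : ℝ) / T2 = C.π1 y * C.xl y i := by rw [hN1, xl, ← hT2]; ring
  have hxl : C.xl y i = (C.fib y).card / T2 := rfl
  have hxl0 := C.xl_nonneg y i
  -- `p ≤ x`
  have hple : C.p y i ≤ C.xl y i := by
    unfold p; rw [hxl, ← hc, add_div]; exact add_le_add hup0 hup
  rw [abs_le]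
  constructor
  · -- lower
    have hlo' : C.π1 y * C.xl y i - C.FailB y true i / T2 - (C.fibB y true).card * ((C.fib y).card - 1) / T2 ^ 2 ≤ C.s y i true := by
      refine le_trans (le_of_eq ?_) hlo
      rw [← hxπ]; field_simp
    have hNN : (C.fibB y true).card * ((C.fib y).card - 1) / T2 ^ 2 ≤ C.xl y i ^ 2 := by
      rw [hxl, div_pow, div_le_div_iff_of_pos_right (pow_pos hpow 2)]
      have hle : ((C.fibB y true).card : ℝ) ≤ (C.fib y).card := by exact_mod_cast Finset.card_le_card (C.fibB_subset y true)
      nlinarith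
    have hFd : C.FailB y true i / T2 ≤ C.Fail y i / T2 := div_le_div_of_nonneg_right hF1 hpow.le
    have hpπ : C.p y i * C.π1 y ≤ C.xl y i * C.π1 y := mul_le_mul_of_nonneg_right hple hπ0
    linarith
  · -- upper
    have hpπ : (C.xl y i - C.Fail y i / T2 - C.xl y i ^ 2) * C.π1 y ≤ C.p y i * C.π1 y := mul_le_mul_of_nonneg_right hp hπ0
    have hbr : 0 ≤ C.Fail y i / T2 + C.xl y i ^ 2 := by positivity
    rw [hxπ] at hup
    nlinarith

end Level

end Ctx

end FarApartOWF

end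

end Literature.Computability.Cryptography
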